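import Literature.Probability.RandomPlanarGeometry.SLERestrictionLemmasProofs
import Literature.Probability.RandomPlanarGeometry.SLETransienceKappaEightHolds
import Literature.Probability.RandomPlanarGeometry.RohdeSchrammCor35Proofs
import Literature.Probability.RandomPlanarGeometry.CritPercSLESimplePathProofs
import HarnessLib

/-!
# [LSW] Lemmas 6.2 and 6.3 along the SLE_κ flow, `0 < κ ≤ 4`: general-`κ` twins of the SLE_{8/3} corollaries of `SLERestrictionLemmas`

G. F. Lawler, O. Schramm, W. Werner, *Conformal restriction: the chordal case*, J. Amer. Math. Soc.
**16** (2003) 917–955, arXiv:math/0209343 (**[LSW]**), §6: Lemma 6.2 ("`lim_{r → ∞} g'_{A_{T(r)}}(W_{T(r)}) = 1`"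
for `A ∈ 𝒬₊` when the hulls never meet `A`) and Lemma 6.3 ("`lim_{t ↗ T} Φ_{A_t}'(W_t) = 0`" at a
finite hitting time, for smooth hulls), and the proof of **Theorem 6.5** ("A similar proof to that of
Theorem 6.1 … gives the following important generalization"): the identification of the terminal
value of the compensated martingale `Y_t = h_t′(W_t)^α exp(λ ∫₀ᵗ Sh_s(W_s)/6 ds)` uses the two lemmas
along the SLE_κ flow for `κ ≤ 8/3` exactly as Thm. 6.1 uses them at `κ = 8/3`.

Both lemmas are vendored in the tree as DETERMINISTIC statements about a continuous driving function
(`Loewner.restrictionDeriv_exitTime_gt`, PROVED: `restrictionDeriv_exitTime_gt_holds`;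
`Loewner.RestrictionDerivVanishesAtHit A`, proved for smooth hulls:
`IsSmoothHull.restrictionDerivVanishesAtHit_holds`), and `SLERestrictionLemmas` derives their
SLE_{8/3} corollaries `sle_restrictionDeriv_frequently_gt/lt`. Here, for every `0 < κ ≤ 4`:

* `sle_restrictionDeriv_frequently_gtK κ A`, `sle_restrictionDeriv_frequently_ltK κ A` — the same
  two almost-sure properties of the SLE_κ flow (the definitions of `SLERestrictionMartingale` with
  `8/3` replaced by `κ`);
* `sle_restrictionDeriv_frequently_gtK_of_isPlusHull` — Lemma 6.2 along SLE_κ for `A ∈ 𝒬₊`,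
  UNCONDITIONALLY (the Rohde–Schramm inputs — generation by a curve `hasSLETrace_of_ne_eight_holds`,
  simplicity for `κ ≤ 4`, transience `tendsto_norm_sleTrace_atTop_of_ne_eight`, swallowing of real
  points `sle_swallowingTime_ofReal_eq_firstHit_holds` — being theorems of the tree);
* `sle_restrictionDeriv_frequently_ltK_of_vanishesAtHit` — Lemma 6.3 along SLE_κ for every `*`-hull
  with the deterministic property, in particular for smooth hulls
  (`sle_restrictionDeriv_frequently_ltK_of_isSmoothHull`).

Proofs: those of `SLERestrictionLemmas`, verbatim (`exists_isExitTime_ge`, `disjoint_closedHull`,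
`isHullHitTime_of_firstHit_eq`, `not_swallowingTime_ofReal_le` are stated there for every `κ`).

## References

* [LSW] Lemma 6.2, Lemma 6.3, proofs of Thm. 6.1 and Thm. 6.5 (§6). [LawlerSchrammWerner2003Restriction]
* S. Rohde, O. Schramm, *Basic properties of SLE* (2005), Thm 5.1, Thm 6.1, Thm 7.1. [RohdeSchramm2005]
-/

noncomputable section

open Set Filter MeasureTheory
open UpperHalfPlane (upperHalfPlaneSet)
open scoped NNReal Topology

namespace Literature.Probability.RandomPlanarGeometry

/-- **The conclusion of [LSW] Lemma 6.2 along the SLE_κ flow and the hull `A`**: almost surely,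
if the trace never hits `A`, then `Φ'_{A_t − W_t}(0) > 1 − ε` at arbitrarily large times
(`sle_restrictionDeriv_frequently_gt` of `SLERestrictionMartingale` is the case `κ = 8/3`).
[cite: LawlerSchrammWerner2003Restriction, Lemma 6.2 and proofs of Thm. 6.1/6.5 (§6)] -/
def sle_restrictionDeriv_frequently_gtK (κ : ℝ≥0) (A : Set ℂ) : Prop :=
  ∀ᵐ ω ∂Process.preWienerMeasure, firstHit (sleTrace κ ω) A = ⊤ →
    ∀ ε : ℝ, 0 < ε → ∃ᶠ t : ℝ≥0 in atTop,
      ∀ (Ψ : ConformalEquiv (upperHalfPlaneSet \ Loewner.slidHull (sleDriving κ ω) A t) upperHalfPlaneSet) (e : ℝ),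
        IsRestrictionMap (Loewner.slidHull (sleDriving κ ω) A t) Ψ →
          HasRestrictionDeriv (Loewner.slidHull (sleDriving κ ω) A t) Ψ e → 1 - ε < e

/-- **The conclusion of [LSW] Lemma 6.3 along the SLE_κ flow and the hull `A`**: almost surely,
if the trace hits `A` at the finite time `T`, then `Φ'_{A_s − W_s}(0) < ε` at times `s ↗ T`
arbitrarily close to `T` (`sle_restrictionDeriv_frequently_lt` is the case `κ = 8/3`).
[cite: LawlerSchrammWerner2003Restriction, Lemma 6.3 and proofs of Thm. 6.1/6.5 (§6)] -/
def sle_restrictionDeriv_frequently_ltK (κ : ℝ≥0) (A : Set ℂ) : Prop :=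
  ∀ᵐ ω ∂Process.preWienerMeasure, ∀ τ : ℝ≥0, firstHit (sleTrace κ ω) A = τ →
    ∀ ε : ℝ, 0 < ε → ∃ᶠ s : ℝ≥0 in 𝓝[<] τ,
      ∀ (Ψ : ConformalEquiv (upperHalfPlaneSet \ Loewner.slidHull (sleDriving κ ω) A s) upperHalfPlaneSet) (e : ℝ),
        IsRestrictionMap (Loewner.slidHull (sleDriving κ ω) A s) Ψ →
          HasRestrictionDeriv (Loewner.slidHull (sleDriving κ ω) A s) Ψ e → e < ε

section SLE

variable {κ : ℝ≥0} {A : Set ℂ}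

/-- **[LSW] Lemma 6.2 along SLE_κ, `0 < κ ≤ 4`, for `A ∈ 𝒬₊`, from the printed deterministic
lemma and the Rohde–Schramm trace facts as hypotheses** (as `sle_restrictionDeriv_frequently_gt_of_isPlusHull`).
[cite: LawlerSchrammWerner2003Restriction, Lemma 6.2 and proof of Thm. 6.5 (§6)] -/
theorem sle_restrictionDeriv_frequently_gtK_of_facts (hκ0 : 0 < κ) (hκ4 : κ ≤ 4)
    (h62 : Loewner.restrictionDeriv_exitTime_gt) (hgen : HasSLETrace κ)
    (h₆ : RandomPlanarGeometry.ae_isSimpleTrace_sleTrace_of_le_four (κ := κ))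
    (htr : ∀ᵐ ω ∂Process.preWienerMeasure, Tendsto (fun t ↦ ‖sleTrace κ ω t‖) atTop atTop)
    (hswallow : sle_swallowingTime_ofReal_eq_firstHit)
    (hA : IsPlusHull A) : sle_restrictionDeriv_frequently_gtK κ A := by
  filter_upwards [ae_isGeneratedByCurve_sleTrace hgen, h₆ hκ0 hκ4, htr] with ω hgenω hsω htrω hT ε hε
  have hdisj : ∀ t, Disjoint (Loewner.closedHull (sleDriving κ ω) t) A :=
    disjoint_closedHull hswallow hgenω hsω (firstHit_eq_top_iff_disjoint.1 hT)
  obtain ⟨r₀, hr₀⟩ := h62 (continuous_sleDriving _ ω) hA hdisj ε hε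
  rw [frequently_atTop]
  intro a
  obtain ⟨r, hr, t, hat, ht⟩ := exists_isExitTime_ge hswallow hgenω hsω htrω a r₀
  exact ⟨t, hat, hr₀ r hr t ht⟩

/-- **[LSW] Lemma 6.2 along SLE_κ for every `0 < κ ≤ 4` and `A ∈ 𝒬₊`, unconditionally** (all the
inputs are theorems of the tree). [cite: LawlerSchrammWerner2003Restriction, Lemma 6.2 and proof of Thm. 6.5 (§6)] -/
theorem sle_restrictionDeriv_frequently_gtK_of_isPlusHull (hκ0 : 0 < κ) (hκ4 : κ ≤ 4) (hA : IsPlusHull A) :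
    sle_restrictionDeriv_frequently_gtK κ A := by
  have hκ8 : κ ≠ 8 := by
    intro h; rw [h] at hκ4; norm_num at hκ4
  exact sle_restrictionDeriv_frequently_gtK_of_facts hκ0 hκ4 Loewner.restrictionDeriv_exitTime_gt_holds
    (hasSLETrace_of_ne_eight_holds hκ8) (ae_isSimpleTrace_sleTrace_of_le_four_of_hasSLETrace_fact hasSLETrace_of_ne_eight_holds)
    (tendsto_norm_sleTrace_atTop_of_ne_eight hκ0 hκ8) sle_swallowingTime_ofReal_eq_firstHit_holds hA

/-- **[LSW] Lemma 6.3 along SLE_κ, `0 < κ ≤ 4`**, for every `*`-hull `A` with the deterministic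
property `Loewner.RestrictionDerivVanishesAtHit A`, from the trace facts as hypotheses
(as `sle_restrictionDeriv_frequently_lt_of_vanishesAtHit`).
[cite: LawlerSchrammWerner2003Restriction, Lemma 6.3 and proof of Thm. 6.5 (§6)] -/
theorem sle_restrictionDeriv_frequently_ltK_of_facts (hκ0 : 0 < κ) (hκ4 : κ ≤ 4) (hgen : HasSLETrace κ)
    (h₆ : RandomPlanarGeometry.ae_isSimpleTrace_sleTrace_of_le_four (κ := κ))
    (hswallow : sle_swallowingTime_ofReal_eq_firstHit) (hA : IsStarHull A)
    (h63 : Loewner.RestrictionDerivVanishesAtHit A) : sle_restrictionDeriv_frequently_ltK κ A := by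
  filter_upwards [ae_isGeneratedByCurve_sleTrace hgen, h₆ hκ0 hκ4] with ω hgenω hsω τ hτ ε hε
  have hτ0 : 0 < τ := by
    have h := firstHit_sleTrace_pos κ hA.isBoundedHull.isClosed hA.zero_notMem ω
    rw [hτ] at h
    exact_mod_cast h
  haveI : (𝓝[<] τ).NeBot := nhdsLT_neBot_of_exists_lt ⟨0, hτ0⟩
  exact (h63 (continuous_sleDriving _ ω) τ
    (isHullHitTime_of_firstHit_eq hswallow hgenω hsω hA.isBoundedHull.isClosed hA.zero_notMem hτ)
    (fun x hx ↦ not_swallowingTime_ofReal_le hswallow hgenω hsω hA.zero_notMem hx τ) ε hε).frequently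

/-- **[LSW] Lemma 6.3 along SLE_κ for every `0 < κ ≤ 4`, unconditionally in the trace facts.**
[cite: LawlerSchrammWerner2003Restriction, Lemma 6.3 and proof of Thm. 6.5 (§6)] -/
theorem sle_restrictionDeriv_frequently_ltK_of_vanishesAtHit (hκ0 : 0 < κ) (hκ4 : κ ≤ 4) (hA : IsStarHull A)
    (h63 : Loewner.RestrictionDerivVanishesAtHit A) : sle_restrictionDeriv_frequently_ltK κ A := by
  have hκ8 : κ ≠ 8 := by
    intro h; rw [h] at hκ4; norm_num at hκ4
  exact sle_restrictionDeriv_frequently_ltK_of_facts hκ0 hκ4 (hasSLETrace_of_ne_eight_holds hκ8)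
    (ae_isSimpleTrace_sleTrace_of_le_four_of_hasSLETrace_fact hasSLETrace_of_ne_eight_holds)
    sle_swallowingTime_ofReal_eq_firstHit_holds hA h63

end SLE

end Literature.Probability.RandomPlanarGeometry

end
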